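import Mathlib.Analysis.Calculus.IteratedDeriv.Lemmas
import Mathlib.Analysis.Calculus.ContDiff.Basic
import Mathlib.Analysis.Complex.Basic
import HarnessLib

/-!
# Mixed partial derivatives of five-variable weights (for quintilinear Kloosterman sums)

Topic `Literature/NumberTheory/Sieve`.  Bounds of Deshouillers–Iwaniec type for quintilinear sums
of Kloosterman fractions (Deshouillers–Iwaniec 1982 Thm 12; Drappeau 2017 Thm 2.1;
Assing–Blomer–Li 2021 Thm 2.3) are stated for smooth weights `g(c,d,n,r,s)` subject to bounds on
all mixed partial derivatives `∂_c^{ν₁}∂_d^{ν₂}∂_n^{ν₃}∂_r^{ν₄}∂_s^{ν₅} g`.  This file provides the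
(definitionally simple, fixed-order) mixed partial derivative `KloostermanQuintilinear.mixedDeriv`
used to state such hypotheses in the tree, and its factorisation for the separable weights
`g = F(c,d)·U(n)·V(r)·W(s)` that occur in applications (Drappeau 2017, §5.5: `F(c,d) =
γ(q₀d)γ(q₀c)α(ξq₀cd)`), reducing the five-variable hypothesis to one- and two-variable calculus.
Everything is proved; one definition (`mixedDeriv`), no named fact.

* `KloostermanQuintilinear.mixedDeriv` — `∂_c^{ν 0}∂_d^{ν 1}∂_n^{ν 2}∂_r^{ν 3}∂_s^{ν 4} g`;
* `mixedDeriv_zero`, `mixedDeriv_single_zero` — API;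
* `mixedDeriv_mul_separable` — for `g c d n r s = F c d * U n * V r * W s`:
  `mixedDeriv ν g = (∂_c^{ν 0}∂_d^{ν 1}F) · U^{(ν 2)} · V^{(ν 3)} · W^{(ν 4)}`.

## References

* S. Drappeau, Proc. London Math. Soc. (3) 114 (2017) 684–732, arXiv:1504.05549, Theorem 2.1 and
  §5.5. [cite: Drappeau2017, Theorem 2.1]
* E. Assing, V. Blomer, J. Li, Adv. Math. 393 (2021), arXiv:2005.13915, Theorem 2.3.
  [cite: AssingBlomerLi2020, Theorem 2.3]
-/

noncomputable section

namespace Literature.NumberTheory.Sieve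

namespace KloostermanQuintilinear

/-- The mixed partial derivative `∂_c^{ν₀} ∂_d^{ν₁} ∂_n^{ν₂} ∂_r^{ν₃} ∂_s^{ν₄} g (c,d,n,r,s)` of a
function of five real variables, taken in this fixed order (for smooth `g` the order is immaterial).
[folklore] -/
def mixedDeriv (ν : Fin 5 → ℕ) (g : ℝ → ℝ → ℝ → ℝ → ℝ → ℂ) (c d n r s : ℝ) : ℂ :=
  iteratedDeriv (ν 0) (fun c' => iteratedDeriv (ν 1) (fun d' => iteratedDeriv (ν 2)
    (fun n' => iteratedDeriv (ν 3) (fun r' => iteratedDeriv (ν 4) (fun s' => g c' d' n' r' s') s) r)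
      n) d) c

/-- Order zero: `mixedDeriv 0 g = g`. [folklore] -/
@[simp] theorem mixedDeriv_zero (g : ℝ → ℝ → ℝ → ℝ → ℝ → ℂ) (c d n r s : ℝ) :
    mixedDeriv 0 g c d n r s = g c d n r s := by
  simp [mixedDeriv]

/-- A pure `c`-derivative: `mixedDeriv (k,0,0,0,0) g = ∂_c^k g`. [folklore] -/
theorem mixedDeriv_single_zero (k : ℕ) (g : ℝ → ℝ → ℝ → ℝ → ℝ → ℂ) (c d n r s : ℝ) :
    mixedDeriv ![k, 0, 0, 0, 0] g c d n r s = iteratedDeriv k (fun c' => g c' d n r s) c := by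
  simp [mixedDeriv]

/-- **Separable weights**: for `g(c,d,n,r,s) = F(c,d) U(n) V(r) W(s)`,
`∂_c^{ν₀}∂_d^{ν₁}∂_n^{ν₂}∂_r^{ν₃}∂_s^{ν₄} g = (∂_c^{ν₀}∂_d^{ν₁} F)(c,d) · U^{(ν₂)}(n) V^{(ν₃)}(r) W^{(ν₄)}(s)`
(no smoothness needed for the identity). [folklore] -/
theorem mixedDeriv_mul_separable (ν : Fin 5 → ℕ) (F : ℝ → ℝ → ℂ) (U V W : ℝ → ℂ)
    (c d n r s : ℝ) :
    mixedDeriv ν (fun c' d' n' r' s' => F c' d' * U n' * V r' * W s') c d n r s =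
      iteratedDeriv (ν 0) (fun c' => iteratedDeriv (ν 1) (fun d' => F c' d') d) c *
        (iteratedDeriv (ν 2) U n * iteratedDeriv (ν 3) V r * iteratedDeriv (ν 4) W s) := by
  unfold mixedDeriv
  -- the `s`-derivative
  have h4 : ∀ c' d' n' r' : ℝ, iteratedDeriv (ν 4) (fun s' => F c' d' * U n' * V r' * W s') s =
      F c' d' * U n' * V r' * iteratedDeriv (ν 4) W s := fun c' d' n' r' =>
    iteratedDeriv_const_mul_field _ _
  simp_rw [h4]
  -- the `r`-derivative
  have h3 : ∀ c' d' n' : ℝ, iteratedDeriv (ν 3) (fun r' => F c' d' * U n' * V r' *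
      iteratedDeriv (ν 4) W s) r = F c' d' * U n' * iteratedDeriv (ν 3) V r * iteratedDeriv (ν 4) W s := by
    intro c' d' n'
    have e : (fun r' => F c' d' * U n' * V r' * iteratedDeriv (ν 4) W s) =
        fun r' => (F c' d' * U n' * iteratedDeriv (ν 4) W s) * V r' := by
      funext r'; ring
    rw [e, iteratedDeriv_const_mul_field]; ring
  simp_rw [h3]
  -- the `n`-derivative
  have h2 : ∀ c' d' : ℝ, iteratedDeriv (ν 2) (fun n' => F c' d' * U n' * iteratedDeriv (ν 3) V r *
      iteratedDeriv (ν 4) W s) n =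
      F c' d' * (iteratedDeriv (ν 2) U n * iteratedDeriv (ν 3) V r * iteratedDeriv (ν 4) W s) := by
    intro c' d'
    have e : (fun n' => F c' d' * U n' * iteratedDeriv (ν 3) V r * iteratedDeriv (ν 4) W s) =
        fun n' => (F c' d' * iteratedDeriv (ν 3) V r * iteratedDeriv (ν 4) W s) * U n' := by
      funext n'; ring
    rw [e, iteratedDeriv_const_mul_field]; ring
  simp_rw [h2]
  -- the `d`- and `c`-derivatives: constants on the right
  simp_rw [iteratedDeriv_mul_const_field]

end KloostermanQuintilinear

end Literature.NumberTheory.Sieve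

end
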